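import Summits.CriticalPhenomena.PercolationContinuityZ3.Theorems.Transplant.FKConnectivityAllQForestNodeScpDuality
import HarnessLib

/-!
# The square-free adjacent forest Rayleigh node as an INJECTION-SHAPED inequality on the rest (the 'Steiner form')

Support file (`--supports stmt-CriticalPhenomena-4575`), FK sub-lane `prim-bschramm-fk-1` (gen 28) of the post-continuity programme;
builds on p205010 (kernel theorem, internal audit signed; external expert review pending).  No definitions, no named facts, no sorries;
standard axioms.

SETTING (as in `…ForestNodeScpDuality`): a fibre `(N ∪ {e,f}, u₀)` of the node (♣)⁰ = `AdjForestRayleighNoSqOn` with `e = ov`, `f = oy` free, `o, v, y`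
distinct, and its rest `(N, u₀)` (the multigraph `H = G − e − f`); `R_v = {o ~ v}`, `R_y = {o ~ y}`, `R_vy = {v ~ y}` (per class).  Write `W(X ; Y)` for the
number of rest colourings whose first class induces the partition `X` of `{o,v,y}` and whose second class induces `Y` (`∅` = all three separated).
g25's duality (`adjForestNoSq_fibre_iff_pp_le`) says: node on the fibre ⟺ `PP ≤ PM + E⁰`.  Splitting `PP` by `R_vy` in the second slot and `E⁰` by the
five patterns of its free slot, and cancelling the common term `W(ovy ; vy) = W(vy ; ovy)` (class swap), gives THIS FILE's
* **`adjForestNoSq_fibre_iff_steiner`**: node on the fibre ⟺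
  **`W(ovy ; ∅) ≤ W(ov ; oy) + W(vy ; ov) + W(vy ; oy) + W(vy ; vy) + W(vy ; ∅)`**
  — every coefficient is ONE, so the node on a fibre is EXACTLY the existence of an injection from the 'source' colourings (first class joins
  `o,v,y`, second class separates them pairwise) into five 'target' classes.  The targets are precisely the images of the STEINER-BRANCH MOVES
  (memo bschramm/FROM-fk-1-g28-TRACE-CONE.md §3–§4): moving the branch of `o` (resp. of `v`, of `y`) of the Steiner tree of `{o,v,y}` in the joining
  class across to the other class lands in `(∅/ov/oy ; vy)` (resp. `(vy/ov ; oy)`, `(vy/oy ; ov)`), i.e. in the transposes of the classes above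
  (`W(X;Y) = W(Y;X)`); `W(vy;vy)` absorbs the chord cases.  Numerically (fk-1 g28): a MONOTONE such injection (only moves out of the joining class,
  one slot per swap-pair of targets) exists for every rest of a (2,3)-sparse `G` with ≤ 9 vertices and ≤ 10 rest pairs (1.27·10¹⁰ sources, kit j225168)
  and fails exactly on tight sets / dense separators — the lineage's equality cases.
[cite: SempleWelsh2008, Conj. 1.1 (p. 2); Thm. 4.2 (p. 11)] [cite: CibulkaHladkyLaCroixWagner2008, Thm. 1 (p. 2)] [cite: Linusson2011, Prop. 2.6]
[cite: Grimmett2006, §1.5 (p. 13)]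
-/

noncomputable section

namespace Summit.CriticalPhenomena.PercolationContinuityZ3.Theorems
namespace FK

open Set Literature.Probability.LatticeModels Literature.Probability.Percolation
open scoped Classical symmDiff

variable {V : Type*} [Fintype V]

section Steiner

variable {N u₀ : BondConfig V} {o v y : V}

/-- **THE STEINER FORM of the node on a fibre with `e = ov`, `f = oy` free**: `bad ≤ good` on `(N ∪ {e,f}, u₀)` ⟺
`W(ovy;∅) ≤ W(ov;oy) + W(vy;ov) + W(vy;oy) + W(vy;vy) + W(vy;∅)` on the rest `(N, u₀)` — an inequality with all coefficients one
(sources: first class joins `o,v,y`, second class separates them; five target classes).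
[cite: SempleWelsh2008, Conj. 1.1 (p. 2)] [cite: CibulkaHladkyLaCroixWagner2008, Thm. 1 (p. 2)] [cite: Linusson2011, Prop. 2.6] -/
theorem adjForestNoSq_fibre_iff_steiner (hov : o ≠ v) (hoy : o ≠ y) (hvy : v ≠ y) (heN : s(o, v) ∉ N) (hfN : s(o, y) ∉ N)
    (heu : s(o, v) ∉ u₀) (hfu : s(o, y) ∉ u₀) :
    fibreCount (insert s(o, y) (insert s(o, v) N)) u₀ (forestEv V ∩ {ω | s(o, v) ∈ ω ∧ s(o, y) ∈ ω}) (forestEv V) ≤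
        fibreCount (insert s(o, y) (insert s(o, v) N)) u₀ (forestEv V ∩ {ω | s(o, v) ∈ ω}) (forestEv V ∩ {ω | s(o, y) ∈ ω}) ↔
      fibreCount N u₀ (forestEv V ∩ reachEv o v ∩ reachEv o y)
          (forestEv V ∩ (reachEv o v)ᶜ ∩ (reachEv o y)ᶜ ∩ (reachEv v y)ᶜ) ≤
        fibreCount N u₀ (forestEv V ∩ reachEv o v ∩ (reachEv o y)ᶜ) (forestEv V ∩ (reachEv o v)ᶜ ∩ reachEv o y) +
          fibreCount N u₀ (forestEv V ∩ reachEv v y ∩ (reachEv o v)ᶜ) (forestEv V ∩ reachEv o v ∩ (reachEv o y)ᶜ) +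
          fibreCount N u₀ (forestEv V ∩ reachEv v y ∩ (reachEv o v)ᶜ) (forestEv V ∩ (reachEv o v)ᶜ ∩ reachEv o y) +
          fibreCount N u₀ (forestEv V ∩ reachEv v y ∩ (reachEv o v)ᶜ) (forestEv V ∩ reachEv v y ∩ (reachEv o v)ᶜ) +
          fibreCount N u₀ (forestEv V ∩ reachEv v y ∩ (reachEv o v)ᶜ)
            (forestEv V ∩ (reachEv o v)ᶜ ∩ (reachEv o y)ᶜ ∩ (reachEv v y)ᶜ) := by
  rw [adjForestNoSq_fibre_iff_pp_le hov hoy hvy heN hfN heu hfu]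
  set F := forestEv V with hF
  set Rv := reachEv (V := V) o v with hRv
  set Ry := reachEv (V := V) o y with hRy
  set Rvy := reachEv (V := V) v y with hRvy
  set S := F ∩ Rvy ∩ Rvᶜ with hS
  have dj : ∀ (X : Set (BondConfig V)) (R : Set (BondConfig V)), Disjoint (X ∩ Rᶜ) (X ∩ R) :=
    fun X R => Set.disjoint_left.2 fun ω h₁ h₂ => h₁.2 h₂.2
  have cover : ∀ (X : Set (BondConfig V)) (R : Set (BondConfig V)), X = (X ∩ Rᶜ) ∪ (X ∩ R) :=
    fun X R => by rw [← inter_union_distrib_left, compl_union_self, inter_univ]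
  -- `{o ≁ v} ∩ {o ≁ y} ∩ {v ~ y} = {v ~ y} ∩ {o ≁ v}`
  have hatom : F ∩ Rvᶜ ∩ Ryᶜ ∩ Rvy = S := by
    ext ω
    simp only [hS, mem_inter_iff, mem_compl_iff, hRv, hRy, hRvy, mem_reachEv]
    constructor
    · rintro ⟨⟨⟨h1, h2⟩, -⟩, h4⟩; exact ⟨⟨h1, h4⟩, h2⟩
    · rintro ⟨⟨h1, h4⟩, h2⟩; exact ⟨⟨⟨h1, h2⟩, fun h3 => h2 (h3.trans h4.symm)⟩, h4⟩
  -- split PP by `Rvy` in the second slot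
  have hPP : fibreCount N u₀ (F ∩ Rv ∩ Ry) (F ∩ Rvᶜ ∩ Ryᶜ) =
      fibreCount N u₀ (F ∩ Rv ∩ Ry) (F ∩ Rvᶜ ∩ Ryᶜ ∩ Rvyᶜ) + fibreCount N u₀ (F ∩ Rv ∩ Ry) (F ∩ Rvᶜ ∩ Ryᶜ ∩ Rvy) := by
    rw [← fibreCount_split_right N u₀ _ (dj (F ∩ Rvᶜ ∩ Ryᶜ) Rvy), ← cover]
  -- split the free slot of E⁰ into the five patterns
  have hE : fibreCount N u₀ S F =
      fibreCount N u₀ S (F ∩ Rvᶜ ∩ Ryᶜ ∩ Rvyᶜ) + fibreCount N u₀ S (F ∩ Rvᶜ ∩ Ryᶜ ∩ Rvy) + fibreCount N u₀ S (F ∩ Rvᶜ ∩ Ry) +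
        (fibreCount N u₀ S (F ∩ Rv ∩ Ryᶜ) + fibreCount N u₀ S (F ∩ Rv ∩ Ry)) := by
    rw [← fibreCount_split_right N u₀ _ (dj (F ∩ Rvᶜ ∩ Ryᶜ) Rvy), ← cover, ← fibreCount_split_right N u₀ _ (dj (F ∩ Rvᶜ) Ry), ← cover,
      ← fibreCount_split_right N u₀ _ (dj (F ∩ Rv) Ry), ← cover, ← fibreCount_split_right N u₀ _ (dj F Rv), ← cover]
  -- the common term `W(ovy ; vy) = W(vy ; ovy)` and the `(vy ; vy)` atom
  have hsw : fibreCount N u₀ (F ∩ Rv ∩ Ry) (F ∩ Rvᶜ ∩ Ryᶜ ∩ Rvy) = fibreCount N u₀ S (F ∩ Rv ∩ Ry) := by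
    rw [hatom, fibreCount_swap]
  have hvv : fibreCount N u₀ S (F ∩ Rvᶜ ∩ Ryᶜ ∩ Rvy) = fibreCount N u₀ S S := by rw [hatom]
  rw [hPP, hE, hsw, hvv]
  omega

end Steiner

end FK
end Summit.CriticalPhenomena.PercolationContinuityZ3.Theorems

end
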